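import Literature.NumberTheory.Sieve.MaynardSieve
import Literature.NumberTheory.Sieve.MaynardSieveWeights
import HarnessLib

/-!
# Maynard 2015, Lemma 6.2 (`S₁` half of Prop. 4.1) reduced to Lemma 5.1 and the smooth sum of its proof

Topic `Literature/NumberTheory/Sieve`; continues `MaynardSieve.lean` (the named fact
`Literature.NumberTheory.Sieve.maynard_S1_asymptotic` = Maynard's Lemma 6.2) and `MaynardSieveWeights.lean` (the variables
`y_r`, `Literature.NumberTheory.Sieve.maynardY`, and their evaluation `maynardY_eq`). J. Maynard, *Small gaps between
primes*, Ann. of Math. (2) 181 (2015), 383–413 = arXiv:1311.4600; pages refer to the arXiv text.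

The printed proof of Lemma 6.2 (pp. 13–14) has two inputs, vendored here as named facts, and a
two-line combination, proved here:

* `Literature.NumberTheory.Sieve.maynard_lemma51` — **Lemma 5.1** (p. 9): `S₁ = (N/W) ∑_r y_r²/∏ φ(rᵢ) + O(y_max² 𝔐/D₀)`,
  `𝔐 = φ(W)^k N (log R)^k / W^{k+1}`, the Selberg-sieve diagonalisation (§5);
* `Literature.NumberTheory.Sieve.maynard_lemma62_sum` — displays **(6.4)–(6.7)** of the proof of Lemma 6.2: with Maynard's
  choice `y_r = F(log rᵢ/log R)` on squarefree `∏ rᵢ` coprime to `W` (which IS the `y` of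
  `λ = maynardWeight`, `maynardY_eq`), `∑_r y_r²/∏ φ(rᵢ) = 𝔐′ (I_k(F) + o(1))`,
  `𝔐′ = φ(W)^k (log R)^k / W^k` (`maynardSumScale`), by `k` applications of the partial-summation
  Lemma 6.1 (Goldston–Graham–Pintz–Yıldırım, Lemma 4);
* `Literature.NumberTheory.Sieve.maynard_S1_asymptotic_of` — PROVED: the two facts give `maynard_S1_asymptotic`
  (`(N/W) 𝔐′ = 𝔐`, `D₀ → ∞`).

So, after this file, the `S₁` half of Prop. 4.1 rests on Lemma 5.1 and (6.4)–(6.7) separately.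

## References

* J. Maynard, *Small gaps between primes*, Ann. of Math. (2) 181 (2015), 383–413,
  doi:10.4007/annals.2015.181.1.7, arXiv:1311.4600 [MaynardAnnals2015]: Lemma 5.1 (p. 9) and its
  proof (pp. 9–10), Lemma 6.1, Lemma 6.2 and its proof (pp. 13–14).
* D. A. Goldston, S. W. Graham, J. Pintz, C. Y. Yıldırım, *Small gaps between products of two
  primes*, Proc. Lond. Math. Soc. (3) 98 (2009), 741–774 = arXiv:math/0609615, Lemma 4 (p. 6)
  (Maynard's Lemma 6.1).
-/

noncomputable section

open Finset Filter Asymptotics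
open scoped BigOperators ArithmeticFunction.Moebius

namespace Literature.NumberTheory.Sieve

/-- The size `φ(W)^k (log R)^k / W^k` of the diagonal sum `∑_r y_r²/∏ φ(rᵢ)` (Maynard 2015, (6.7));
`(N/W) · maynardSumScale = maynardMainTerm`. [cite: MaynardAnnals2015, proof of Lemma 6.2] -/
def maynardSumScale (k : ℕ) (θ δ : ℝ) (N : ℕ) : ℝ :=
  (Nat.totient (maynardW N) : ℝ) ^ k * Real.log (maynardR θ δ N) ^ k / (maynardW N : ℝ) ^ k

/-- **Maynard 2015, Lemma 5.1** (p. 9), for `λ_d = maynardWeight k F R W d` with `F = G · 1_{R_k}`,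
`G` continuous (so that `y_max ≤ sup_{R_k} |G| < ∞`), distinct shifts `hᵢ`, `R = N^{θ/2−δ}`
(`0 < δ`, `0 < θ/2 − δ`, `θ ≤ 1`, whence `R² ≤ N^{1−2δ}` and the second error term of (5.13) is
dominated), `W = ∏_{p ≤ D₀} p`, and any residue `v₀ = v₀(N)`:
`S₁ = (N/W) ∑_{r} y_r² / ∏ φ(rᵢ) + O(y_max² φ(W)^k N (log R)^k / (W^{k+1} D₀))`, the `y_r` being
Maynard's variables (`maynardY`, Lemma 5.1; by `maynardY_eq` they are `μ(∏rᵢ)² 1[(rᵢ,W)=1] F(log rᵢ/log R)`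
on the box and `0` outside). Vendored with the implied constant depending on the fixed data
(`k, h, θ, δ, G`). A deep-ish elementary input (Selberg-sieve diagonalisation: CRT count in residue
classes, `1/[d,e] = (1/de) ∑_{u ∣ d,e} φ(u)`, removal of the cross-conditions `(dᵢ, eⱼ) = 1`, and the
bounds `λ_max ≪ y_max (log R)^k`, `∑_{u<R} μ²(u)/φ(u) ≪ log R`), vendored as a named fact.
[cite: MaynardAnnals2015, Lemma 5.1] -/
def maynard_lemma51 : Prop :=
  ∀ (k : ℕ), 0 < k → ∀ (h : Fin k → ℤ), Function.Injective h →
  ∀ (θ δ : ℝ), 0 < δ → 0 < θ / 2 - δ → θ ≤ 1 →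
  ∀ (G : (Fin k → ℝ) → ℝ), Continuous G →
  ∀ (v₀ : ℕ → ℕ),
    (fun N : ℕ => maynardS1 k h ((maynardSimplex k).indicator G) (maynardR θ δ N) (maynardW N) (v₀ N) N
        - (N : ℝ) / (maynardW N) * ∑ r ∈ maynardBox k (maynardR θ δ N),
            maynardY k ((maynardSimplex k).indicator G) (maynardR θ δ N) (maynardW N) r ^ 2 /
              ∏ i, (Nat.totient (r i) : ℝ))
      =O[atTop] fun N => maynardMainTerm k θ δ N / (maynardD0 N : ℝ)

/-- **Maynard 2015, proof of Lemma 6.2, displays (6.4)–(6.7)** (pp. 13–14): with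
`y_r = μ(∏rᵢ)² 1[(rᵢ,W)=1] F(log rᵢ/log R)` (`F = G · 1_{R_k}`, `G ∈ C¹`),
`∑_r y_r²/∏ φ(rᵢ) = ∑_{(uᵢ,uⱼ)=1, (uᵢ,W)=1} ∏ μ(uᵢ)²/φ(uᵢ) F(log uᵢ/log R)²`; dropping the conditions
`(uᵢ, uⱼ) = 1` costs `O(F_max² φ(W)^k (log R)^k/(W^k D₀))` (display (6.5), divided by `N/W`), and
`k` applications of Lemma 6.1 (= Goldston–Graham–Pintz–Yıldırım, Lemma 4) with `κ = 1`,
`γ(p) = 1_{p ∤ W}`, `L ≪ log D₀` give (6.7):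
`∑_{(uᵢ,W)=1} ∏ μ(uᵢ)²/φ(uᵢ) F(log uᵢ/log R)² = φ(W)^k (log R)^k/W^k · I_k(F) + O(F_max² φ(W)^k log D₀ (log R)^{k−1}/W^k)`.
Vendored in the `o`-form (both errors are `o(φ(W)^k (log R)^k/W^k)` since `D₀ → ∞` and
`log D₀ / log R → 0`). A deep input (partial summation against the sieve mean value
`∑_{d<z} μ²(d) g(d)`, Halberstam–Richert Lemmas 5.3–5.4), vendored as a named fact.
[cite: MaynardAnnals2015, proof of Lemma 6.2] -/
def maynard_lemma62_sum : Prop :=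
  ∀ (k : ℕ), 0 < k → ∀ (θ δ : ℝ), 0 < δ → 0 < θ / 2 - δ →
  ∀ (G : (Fin k → ℝ) → ℝ), ContDiff ℝ 1 G →
    (fun N : ℕ => ∑ r ∈ maynardBox k (maynardR θ δ N),
          maynardY k ((maynardSimplex k).indicator G) (maynardR θ δ N) (maynardW N) r ^ 2 /
            ∏ i, (Nat.totient (r i) : ℝ)
        - maynardSumScale k θ δ N * maynardI k ((maynardSimplex k).indicator G))
      =o[atTop] maynardSumScale k θ δ

/-- `D₀ = ⌊log log log N⌋ → ∞`. [folklore] -/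
theorem tendsto_maynardD0_atTop : Tendsto (fun N : ℕ => (maynardD0 N : ℝ)) atTop atTop := by
  have h1 : Tendsto (fun N : ℕ => Real.log (Real.log (Real.log (N : ℝ)))) atTop atTop :=
    Real.tendsto_log_atTop.comp (Real.tendsto_log_atTop.comp
      (Real.tendsto_log_atTop.comp tendsto_natCast_atTop_atTop))
  have h2 : Tendsto (fun N : ℕ => maynardD0 N) atTop atTop :=
    tendsto_nat_floor_atTop.comp h1
  exact tendsto_natCast_atTop_atTop.comp h2

/-- `(N/W) · φ(W)^k (log R)^k / W^k = φ(W)^k N (log R)^k / W^{k+1}`. [folklore] -/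
theorem div_mul_maynardSumScale (k : ℕ) (θ δ : ℝ) (N : ℕ) :
    (N : ℝ) / (maynardW N) * maynardSumScale k θ δ N = maynardMainTerm k θ δ N := by
  unfold maynardSumScale maynardMainTerm
  have hW : (maynardW N : ℝ) ≠ 0 := by exact_mod_cast (primorial_pos _).ne'
  rw [pow_succ]
  field_simp

/-- **Maynard 2015, Lemma 6.2 assembled**: Lemma 5.1 (`maynard_lemma51`) and the smooth-sum
evaluation (6.4)–(6.7) (`maynard_lemma62_sum`) give the `S₁` half of Prop. 4.1,
`maynard_S1_asymptotic` ("We now combine (6.7) with (6.4) and (6.5) to obtain the result", p. 14):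
`S₁ − 𝔐 I = [S₁ − (N/W)Σ] + (N/W)[Σ − 𝔐′ I]` with `(N/W)𝔐′ = 𝔐`, the first bracket `O(𝔐/D₀) = o(𝔐)`
(`D₀ → ∞`), the second `(N/W) · o(𝔐′) = o(𝔐)`. [cite: MaynardAnnals2015, Lemma 6.2 and its proof] -/
theorem maynard_S1_asymptotic_of (h51 : maynard_lemma51) (h62 : maynard_lemma62_sum) :
    maynard_S1_asymptotic := by
  intro k hk h hinj θ δ hδ hη hθ1 G hG v₀ _hv₀
  have e51 := h51 k hk h hinj θ δ hδ hη hθ1 G hG.continuous v₀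
  have e62 := h62 k hk θ δ hδ hη G hG
  set F := (maynardSimplex k).indicator G with hF
  set MT := maynardMainTerm k θ δ with hMT
  set Sg : ℕ → ℝ := fun N => ∑ r ∈ maynardBox k (maynardR θ δ N),
      maynardY k F (maynardR θ δ N) (maynardW N) r ^ 2 / ∏ i, (Nat.totient (r i) : ℝ) with hSg
  -- first bracket: O(MT/D₀) = o(MT)
  have h1 : (fun N : ℕ => maynardS1 k h F (maynardR θ δ N) (maynardW N) (v₀ N) N
      - (N : ℝ) / (maynardW N) * Sg N) =o[atTop] MT := by
    refine e51.trans_isLittleO ?_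
    rw [Asymptotics.isLittleO_iff]
    intro c hc
    have hev : ∀ᶠ N : ℕ in atTop, 1 / c ≤ (maynardD0 N : ℝ) :=
      (tendsto_atTop.mp tendsto_maynardD0_atTop) (1 / c)
    filter_upwards [hev] with N hN
    have hD : 0 < (maynardD0 N : ℝ) := lt_of_lt_of_le (by positivity) hN
    rw [norm_div, Real.norm_of_nonneg hD.le, div_le_iff₀ hD]
    calc ‖MT N‖ = c * (1 / c) * ‖MT N‖ := by field_simp
      _ ≤ c * (maynardD0 N : ℝ) * ‖MT N‖ := by gcongr
      _ = c * ‖MT N‖ * (maynardD0 N : ℝ) := by ring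
  -- second bracket: (N/W) · o(𝔐′) = o(MT)
  have h2 : (fun N : ℕ => (N : ℝ) / (maynardW N) * (Sg N - maynardSumScale k θ δ N * maynardI k F))
      =o[atTop] MT := by
    have h := (isBigO_refl (fun N : ℕ => (N : ℝ) / (maynardW N)) atTop).mul_isLittleO e62
    refine h.congr' EventuallyEq.rfl (Eventually.of_forall fun N => ?_)
    simp only [hMT]
    exact div_mul_maynardSumScale k θ δ N
  -- combine
  have h3 := h1.add h2
  refine h3.congr' (Eventually.of_forall fun N => ?_) EventuallyEq.rfl
  have hN := div_mul_maynardSumScale k θ δ N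
  simp only [hMT]
  rw [← hN]
  ring

end Literature.NumberTheory.Sieve
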